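import Mathlib.Analysis.InnerProductSpace.PiL2
import Mathlib.Analysis.Calculus.FDeriv.Add
import Mathlib.Analysis.Calculus.FDeriv.Mul
import Mathlib.Analysis.Calculus.Deriv.Comp
import Mathlib.Analysis.Calculus.Deriv.Mul
import Mathlib.Analysis.Calculus.Deriv.Add
import Mathlib.Analysis.Calculus.ContDiff.Basic
import Mathlib.Analysis.Calculus.MeanValue
import Mathlib.Analysis.SpecialFunctions.SmoothTransition
import HarnessLib

/-!
# Holonomic approximation, preliminaries: coordinates, partial derivatives, plateau functions

Topic `Literature/Topology/Immersions` (the `h`-principle engine behind the named fact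
`Literature.Topology.Immersions.Phillips1967_exists_isLocalDiffeomorph_of_isParallelizable`:
Eliashberg–Mishachev's *holonomic approximation theorem*, *Introduction to the `h`-principle*
(2002), Thm. 3.1.1–3.1.2, for `1`-jets of maps `ℝⁿ → G` over a cube of positive codimension).
This file collects the coordinate calculus on `ℝⁿ = EuclideanSpace ℝ (Fin n)` used by the
explicit construction (`HolonomicApproxWiggle.lean`) and its estimates
(`HolonomicApproxCube.lean`). Everything is **proved**; no named facts.

* `hasDerivAt_comp_add_smul` — partial derivatives as derivatives along coordinate lines;
* `opNorm_le_sum_norm_apply_single` — `‖L‖ ≤ ∑ᵢ ‖L eᵢ‖` for a continuous linear map out of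
  `ℝⁿ`;
* `exists_plateau₁` — smooth plateau functions of one variable (`= 1` on `[-l, l]`, `= 0` off
  `(-l', l')`, values in `[0, 1]`), from Mathlib's `Real.smoothTransition`.

## References

* Y. Eliashberg, N. Mishachev, *Introduction to the `h`-principle*, GSM 48, AMS (2002), §3.1–3.4.
  [EliashbergMishachev2002]
* M. Gromov, *Partial differential relations* (1986), 2.2.1. [Gromov1986PDR]
-/

open scoped Topology ContDiff
open Set Function Filter

noncomputable section

namespace Literature.Topology.Immersions.HolonomicApprox

variable {n : ℕ} {G : Type*} [NormedAddCommGroup G] [NormedSpace ℝ G]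

/-! ### Coordinates -/

/-- The `i`-th coordinate vector `eᵢ` of `ℝⁿ`. [folklore] -/
abbrev eV (i : Fin n) : EuclideanSpace ℝ (Fin n) := EuclideanSpace.single i 1

/-- `eᵢ i = 1`. [folklore] -/
@[simp] theorem eV_apply_self (i : Fin n) : (eV i : EuclideanSpace ℝ (Fin n)) i = 1 := by
  simp [eV]

/-- `eᵢ j = 0` for `j ≠ i`. [folklore] -/
theorem eV_apply_of_ne {i j : Fin n} (h : j ≠ i) : (eV i : EuclideanSpace ℝ (Fin n)) j = 0 := by
  simp [eV, h]

/-- Coordinates along a coordinate line: `(z + s eⱼ) j = z j + s`. [folklore] -/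
@[simp] theorem add_smul_eV_apply_self (z : EuclideanSpace ℝ (Fin n)) (s : ℝ) (j : Fin n) :
    (z + s • eV j) j = z j + s := by
  simp [eV]

/-- Coordinates along a coordinate line: `(z + s eⱼ) i = z i` for `i ≠ j`. [folklore] -/
theorem add_smul_eV_apply_of_ne (z : EuclideanSpace ℝ (Fin n)) (s : ℝ) {i j : Fin n} (h : i ≠ j) :
    (z + s • eV j) i = z i := by
  simp [eV, h]

/-- Coordinates along a coordinate line, with a conditional. [folklore] -/
theorem add_smul_eV_apply (z : EuclideanSpace ℝ (Fin n)) (s : ℝ) (j i : Fin n) :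
    (z + s • eV j) i = z i + if i = j then s else 0 := by
  by_cases h : i = j
  · subst h; simp
  · rw [if_neg h, add_zero]; exact add_smul_eV_apply_of_ne z s h

/-- `‖eᵢ‖ = 1`. [folklore] -/
@[simp] theorem norm_eV (i : Fin n) : ‖(eV i : EuclideanSpace ℝ (Fin n))‖ = 1 := by
  simp [eV]

/-- A coordinate is bounded by the norm. [folklore] -/
theorem abs_apply_le_norm (z : EuclideanSpace ℝ (Fin n)) (i : Fin n) : |z i| ≤ ‖z‖ := by
  have := PiLp.norm_apply_le z i
  rwa [Real.norm_eq_abs] at this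

/-- Expansion of a vector of `ℝⁿ` in the coordinate vectors. [folklore] -/
theorem sum_apply_smul_eV (v : EuclideanSpace ℝ (Fin n)) : ∑ i, v i • (eV i : EuclideanSpace ℝ (Fin n)) = v := by
  ext j
  simp only [eV, WithLp.ofLp_sum, WithLp.ofLp_smul, Finset.sum_apply, Pi.smul_apply,
    EuclideanSpace.single, smul_eq_mul]
  rw [Finset.sum_eq_single j]
  · simp
  · intro i _ hij; simp [Ne.symm hij]
  · intro hj; exact absurd (Finset.mem_univ j) hj

/-- Coordinate functions are smooth. [folklore] -/
theorem contDiff_coord (i : Fin n) {m : WithTop ℕ∞} :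
    ContDiff ℝ m fun z : EuclideanSpace ℝ (Fin n) => z i :=
  (EuclideanSpace.proj (𝕜 := ℝ) i).contDiff

/-- Coordinate functions have derivative `v ↦ v i`. [folklore] -/
theorem hasFDerivAt_coord (i : Fin n) (z : EuclideanSpace ℝ (Fin n)) :
    HasFDerivAt (fun z : EuclideanSpace ℝ (Fin n) => z i) (EuclideanSpace.proj (𝕜 := ℝ) i) z :=
  (EuclideanSpace.proj (𝕜 := ℝ) i).hasFDerivAt

/-! ### Partial derivatives along coordinate lines -/

/-- **Partial derivatives as derivatives along coordinate lines**: if `g` is differentiable at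
`z` then `s ↦ g (z + s v)` has derivative `dg_z v` at `s = 0`. [folklore] -/
theorem hasDerivAt_comp_add_smul {E : Type*} [NormedAddCommGroup E] [NormedSpace ℝ E]
    {g : E → G} {z : E} (hg : DifferentiableAt ℝ g z) (v : E) :
    HasDerivAt (fun s : ℝ => g (z + s • v)) (fderiv ℝ g z v) 0 := by
  have hℓ : HasDerivAt (fun s : ℝ => z + s • v) v 0 := by
    have := ((hasDerivAt_id (0 : ℝ)).smul_const v).const_add z
    simpa using this
  have h := hg.hasFDerivAt
  rw [show z = z + (0 : ℝ) • v by simp] at h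
  have h2 := h.comp_hasDerivAt (0 : ℝ) hℓ
  simp only [zero_smul, add_zero] at h2
  exact h2

/-- The same at a general time `s₀`: `s ↦ g (z + s v)` has derivative `dg_{z + s₀ v} v` at `s₀`.
[folklore] -/
theorem hasDerivAt_comp_add_smul_at {E : Type*} [NormedAddCommGroup E] [NormedSpace ℝ E]
    {g : E → G} {z : E} (v : E) {s₀ : ℝ} (hg : DifferentiableAt ℝ g (z + s₀ • v)) :
    HasDerivAt (fun s : ℝ => g (z + s • v)) (fderiv ℝ g (z + s₀ • v) v) s₀ := by
  have hℓ : HasDerivAt (fun s : ℝ => z + s • v) v s₀ := by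
    have := ((hasDerivAt_id s₀).smul_const v).const_add z
    simpa using this
  exact hg.hasFDerivAt.comp_hasDerivAt s₀ hℓ

/-- **Uniqueness of partial derivatives**: if `s ↦ g (z + s v)` has derivative `w` at `0` and
`g` is differentiable at `z`, then `dg_z v = w`. [folklore] -/
theorem fderiv_apply_eq_of_hasDerivAt {E : Type*} [NormedAddCommGroup E] [NormedSpace ℝ E]
    {g : E → G} {z : E} (hg : DifferentiableAt ℝ g z) {v : E} {w : G}
    (h : HasDerivAt (fun s : ℝ => g (z + s • v)) w 0) : fderiv ℝ g z v = w :=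
  (hasDerivAt_comp_add_smul hg v).unique h

/-! ### Operator norm from partial derivatives -/

/-- **`‖L‖ ≤ ∑ᵢ ‖L eᵢ‖`** for a continuous linear map out of `ℝⁿ` (each coordinate is bounded by
the Euclidean norm). [folklore] -/
theorem opNorm_le_sum_norm_apply_eV (L : EuclideanSpace ℝ (Fin n) →L[ℝ] G) :
    ‖L‖ ≤ ∑ i, ‖L (eV i)‖ := by
  refine ContinuousLinearMap.opNorm_le_bound _ (Finset.sum_nonneg fun i _ => norm_nonneg _)
    fun v => ?_
  calc ‖L v‖ = ‖∑ i, v i • L (eV i)‖ := by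
        conv_lhs => rw [← sum_apply_smul_eV v]
        simp [map_sum, map_smul]
    _ ≤ ∑ i, ‖v i • L (eV i)‖ := norm_sum_le _ _
    _ = ∑ i, |v i| * ‖L (eV i)‖ := by simp [norm_smul]
    _ ≤ ∑ i, ‖v‖ * ‖L (eV i)‖ := Finset.sum_le_sum fun i _ =>
        mul_le_mul_of_nonneg_right (abs_apply_le_norm v i) (norm_nonneg _)
    _ = (∑ i, ‖L (eV i)‖) * ‖v‖ := by rw [Finset.sum_mul]; simp [mul_comm]

/-- If every partial of `L` has norm `≤ c` then `‖L‖ ≤ n c`. [folklore] -/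
theorem opNorm_le_mul_of_forall_norm_apply_eV_le (L : EuclideanSpace ℝ (Fin n) →L[ℝ] G) {c : ℝ}
    (h : ∀ i, ‖L (eV i)‖ ≤ c) : ‖L‖ ≤ n * c := by
  refine (opNorm_le_sum_norm_apply_eV L).trans ?_
  calc ∑ i, ‖L (eV i)‖ ≤ ∑ _i : Fin n, c := Finset.sum_le_sum fun i _ => h i
    _ = n * c := by simp

/-! ### Plateau functions of one real variable -/

/-- **Smooth plateau functions**: for `l < l'` there is a smooth `β : ℝ → [0, 1]` with
`β = 1` on `[-l, l]` and `β = 0` off `(-l', l')`. [folklore] -/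
theorem exists_plateau₁ {l l' : ℝ} (hll' : l < l') :
    ∃ β : ℝ → ℝ, ContDiff ℝ ∞ β ∧ (∀ s, β s ∈ Icc (0 : ℝ) 1) ∧
      (∀ s, |s| ≤ l → β s = 1) ∧ (∀ s, l' ≤ |s| → β s = 0) := by
  have hgap : 0 < l' - l := by linarith
  refine ⟨fun s => Real.smoothTransition ((s + l') / (l' - l)) *
      Real.smoothTransition ((l' - s) / (l' - l)), ?_, fun s => ?_, fun s hs => ?_, fun s hs => ?_⟩
  · exact (Real.smoothTransition.contDiff.comp ((contDiff_id.add contDiff_const).div_const _)).mul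
      (Real.smoothTransition.contDiff.comp ((contDiff_const.sub contDiff_id).div_const _))
  · exact ⟨mul_nonneg (Real.smoothTransition.nonneg _) (Real.smoothTransition.nonneg _),
      mul_le_one₀ (Real.smoothTransition.le_one _) (Real.smoothTransition.nonneg _)
        (Real.smoothTransition.le_one _)⟩
  · rw [abs_le] at hs
    show Real.smoothTransition _ * Real.smoothTransition _ = 1
    rw [Real.smoothTransition.one_of_one_le, Real.smoothTransition.one_of_one_le, mul_one]
    · rw [le_div_iff₀ hgap]; linarith [hs.2]
    · rw [le_div_iff₀ hgap]; linarith [hs.1]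
  · show Real.smoothTransition _ * Real.smoothTransition _ = 0
    rcases le_abs'.1 hs with h | h
    · rw [Real.smoothTransition.zero_of_nonpos, zero_mul]
      exact div_nonpos_of_nonpos_of_nonneg (by linarith) hgap.le
    · rw [Real.smoothTransition.zero_of_nonpos (x := (l' - s) / (l' - l)), mul_zero]
      exact div_nonpos_of_nonpos_of_nonneg (by linarith) hgap.le

/-- A plateau function has bounded derivative (it is smooth and eventually constant in both
directions, so its derivative has compact support). [folklore] -/
theorem exists_plateau₁_deriv_bound {l l' : ℝ} (hll' : l < l') :
    ∃ β : ℝ → ℝ, ContDiff ℝ ∞ β ∧ (∀ s, β s ∈ Icc (0 : ℝ) 1) ∧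
      (∀ s, |s| ≤ l → β s = 1) ∧ (∀ s, l' ≤ |s| → β s = 0) ∧
      ∃ C : ℝ, 0 ≤ C ∧ ∀ s, |deriv β s| ≤ C := by
  obtain ⟨β, hβ, h01, h1, h0⟩ := exists_plateau₁ hll'
  refine ⟨β, hβ, h01, h1, h0, ?_⟩
  -- the derivative is continuous and vanishes off `[-l', l']`
  have hcont : Continuous (deriv β) := hβ.continuous_deriv (by simp)
  have hzero : ∀ s, l' < |s| → deriv β s = 0 := by
    intro s hs
    have hev : β =ᶠ[𝓝 s] fun _ => 0 := by
      have hopen : IsOpen {s' : ℝ | l' < |s'|} := isOpen_lt continuous_const continuous_abs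
      filter_upwards [hopen.mem_nhds hs] with s' hs'
      exact h0 s' (le_of_lt hs')
    rw [hev.deriv_eq]; exact deriv_const s 0
  obtain ⟨C, hC⟩ := (isCompact_Icc (a := -l') (b := l')).exists_bound_of_continuousOn
    hcont.continuousOn
  refine ⟨max C 0, le_max_right _ _, fun s => ?_⟩
  by_cases hs : |s| ≤ l'
  · have := hC s (abs_le.1 hs)
    rw [Real.norm_eq_abs] at this
    exact this.trans (le_max_left _ _)
  · rw [hzero s (not_le.1 hs), abs_zero]; exact le_max_right _ _

end Literature.Topology.Immersions.HolonomicApprox
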